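import Summits.QuantumFields.YangMills.Theorems.AlphaInputsT3ACv3StartDefectBox
import HarnessLib

/-!
# `AlphaInputsT3ACv3AxialLine` — non-abelian (FL), START v3 row (S6), the LINE LETTER: **two finest fields that agree on the `L^k` bonds of the straight centre line `ĉ₋ → ĉ₊` of a
# level-`k` bond `c` have the same comb-axial transport `axialT · ĉ₋ ĉ₊`** — the binder `hline` of `StartDefectBox.norm_startDefect_sub_one_le_of_box` read directly off (S5)-4's
# `startU_apply_of_quiet` (the centre line meets no tube and no ball of START v3) — cell `ym3-torus`, width seat `ym-ust-19936-w5` (g2), row (S6) of ★w1-19936 g2 LEAD memo §3 (D)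

WHY.  The (S6) box form (✓ p601387) takes `hline : axialT U ĉ₋ ĉ₊ = axialT (iterSec k V) ĉ₋ ĉ₊`; the comb `Γ_{ĉ₋ĉ₊}` is the straight fine line from the centre `ĉ₋ = toFine k c₋` through `L^k`
bonds in direction `c.dir` (no wrap-around for `2L^k ≤ sitesPerDir 0`), so `hline` is «`U⁰ = iterSec k V` on those `L^k` bonds».  THIS FILE proves exactly that reduction:
`lineVec μ N` (def: the integer vector `N·e_μ`), `transl_lineVec` (`transl y (N·e_μ) = shift_μ^{[N]} y`), `rel_lineVec` (`rel y (shift^{[N]} y) = N·e_μ` for `2N ≤ n`),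
`treeWord_lineVec` (the comb word of `N·e_μ` is `N` forward letters `μ`), `mem_walk_replicate` (the walk they spell traverses the bonds `⟨shift^{[t]} y, μ⟩`, `t < N`),
★ `axialT_line_congr`, `toFine_shift` (`toFine k (y + e_μ) = shift_μ^{[L^k]} (toFine k y)`: the next centre is `L^k` fine steps away — `val_toFine`, `sitesPerDir 0 = sitesPerDir k · L^k`),
★★ `axialT_centre_congr` (for a level-`k` bond `c`: agreement on the `L^k` centre-line bonds ⟹ equal transports `ĉ₋ → ĉ₊`).
HONEST FRAMING.  Torus-word bookkeeping; count-neutral helper toward R3 2′ (items 19936∕19935, `--supports stmt-QuantumFields-19936`); `hLift`∕(FL), the stub, the crux and the gap are NOT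
claimed; registry untouched; YM₃ on T³ is rung R3 of the YM ladder, not the Clay problem.

References: T. Bałaban, Commun. Math. Phys. 98 (1985) 17–51 [Balaban1985Averaging] ((8)–(9) p.18, pp.24–25); Commun. Math. Phys. 109 (1987) 249–301 [Balaban1987RG1] ((0.1) p.251).
-/

set_option autoImplicit false

namespace Summit.QuantumFields.YangMills.Theorems.StartDefectBox

open Literature.MathematicalPhysics.QuantumFieldTheory.Balaban1983to89
open T4Continuum
open Literature.MathematicalPhysics.QuantumFieldTheory.Balaban1983to89.B10Eq38TorusDomains (toFine)
open Literature.MathematicalPhysics.QuantumFieldTheory.Balaban1983to89.B10Eq27TorusAxialLog (axialT rel transl transl_zero transl_add_e rel_transl_of_mem)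
open Literature.MathematicalPhysics.QuantumFieldTheory.Balaban1983to89.B7Prop1Explicit (treeWord seg e e_apply seg_natCast)
open Summit.QuantumFields.YangMills.Theorems.LinearLiftSpread (val_toFine)
open Summit.QuantumFields.YangMills.Theorems.Prop7FlatHolonomy (sitesPerDir_zero_eq_mul_pow)

variable {P : Params}

/-! ## §1 The straight line as a comb word -/

/-- The integer vector `N·e_μ`. [folklore] -/
def lineVec {d : ℕ} (μ : Fin d) (N : ℕ) : B7Prop1Explicit.Site d := fun κ => if κ = μ then (N : ℤ) else 0

/-- `0·e_μ = 0`. [folklore] -/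
theorem lineVec_zero {d : ℕ} (μ : Fin d) : lineVec μ 0 = 0 := by
  funext κ; simp [lineVec]

/-- `(N+1)·e_μ = N·e_μ + e_μ`. [folklore] -/
theorem lineVec_succ {d : ℕ} (μ : Fin d) (N : ℕ) : lineVec μ (N + 1) = lineVec μ N + e μ := by
  funext κ
  simp only [lineVec, Pi.add_apply, e_apply]
  by_cases h : κ = μ
  · simp [h]
  · simp [h]

/-- `y + N·e_μ` is `y` shifted `N` times in direction `μ`. [cite: Balaban1987RG1, (0.1) p.251] -/
theorem transl_lineVec {j : ℕ} (y : Site P j) (μ : Fin P.d) : ∀ N : ℕ, transl y (lineVec μ N) = (fun z : Site P j => z.shift μ)^[N] y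
  | 0 => by rw [lineVec_zero, transl_zero, Function.iterate_zero, id]
  | N + 1 => by rw [lineVec_succ, transl_add_e, transl_lineVec y μ N, Function.iterate_succ_apply']

/-- **No wrap-around on a line of `N` steps** (`2N ≤ n`): the relative position of `shift_μ^{[N]} y` from `y` is `N·e_μ`. [cite: Balaban1985Averaging, pp.24–25] -/
theorem rel_lineVec {j : ℕ} (y : Site P j) (μ : Fin P.d) (N : ℕ) (hN : (N : ℤ) * 2 ≤ (P.sitesPerDir j : ℤ)) :
    rel y ((fun z : Site P j => z.shift μ)^[N] y) = lineVec μ N := by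
  rw [← transl_lineVec]
  refine rel_transl_of_mem y _ fun ν => ?_
  have hn : (0 : ℤ) < (P.sitesPerDir j : ℤ) := by exact_mod_cast Nat.pos_of_ne_zero (P.sitesPerDir_ne_zero j)
  simp only [lineVec]
  by_cases h : ν = μ
  · rw [if_pos h]
    have h0 : (0 : ℤ) ≤ (N : ℤ) * 2 := by positivity
    exact ⟨by linarith, hN⟩
  · rw [if_neg h]; exact ⟨by linarith, by linarith⟩

/-- A flat-map in which only the entry `μ` of a duplicate-free list contributes is that entry's contribution. [folklore] -/
theorem flatMap_ite_eq_nil_of_not_mem {α β : Type*} [DecidableEq α] (L : List α) (μ : α) (R : List β) (h : μ ∉ L) :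
    L.flatMap (fun κ => if κ = μ then R else []) = [] := by
  induction L with
  | nil => rfl
  | cons a L ih =>
    rw [List.flatMap_cons, ih (fun hm => h (List.mem_cons_of_mem a hm)), List.append_nil, if_neg]
    exact fun ha => h (ha ▸ List.mem_cons_self)

/-- A flat-map in which only the entry `μ` of a duplicate-free list contributes is that entry's contribution. [folklore] -/
theorem flatMap_ite_eq_of_nodup {α β : Type*} [DecidableEq α] (L : List α) (μ : α) (R : List β) (hL : L.Nodup) (h : μ ∈ L) :
    L.flatMap (fun κ => if κ = μ then R else []) = R := by
  induction L with
  | nil => exact absurd h List.not_mem_nil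
  | cons a L ih =>
    rw [List.flatMap_cons]
    rw [List.nodup_cons] at hL
    by_cases ha : a = μ
    · subst ha
      rw [if_pos rfl, flatMap_ite_eq_nil_of_not_mem L a R hL.1, List.append_nil]
    · rw [if_neg ha, List.nil_append]
      rcases List.mem_cons.mp h with h' | h'
      · exact absurd h'.symm ha
      · exact ih hL.2 h'

/-- **THE COMB WORD OF `N·e_μ` IS `N` FORWARD LETTERS `μ`.** [cite: Balaban1985Averaging, pp.24–25] -/
theorem treeWord_lineVec {d : ℕ} (μ : Fin d) (N : ℕ) : treeWord (lineVec μ N) = List.replicate N (μ, true) := by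
  unfold treeWord
  have hf : (fun κ : Fin d => seg κ (lineVec μ N κ)) = fun κ => if κ = μ then List.replicate N (μ, true) else [] := by
    funext κ
    simp only [lineVec]
    by_cases h : κ = μ
    · rw [if_pos h, if_pos h, h, seg_natCast]
    · rw [if_neg h, if_neg h]; rfl
  rw [hf]
  exact flatMap_ite_eq_of_nodup _ μ _ (List.nodup_reverse.mpr (List.nodup_finRange d)) (List.mem_reverse.mpr (List.mem_finRange μ))

/-- The walk spelled by `N` forward letters `μ` from `y` traverses exactly the bonds `⟨shift_μ^{[t]} y, μ⟩`, `t < N`. [cite: Balaban1985Averaging, (8) p.18] -/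
theorem mem_walk_replicate {j : ℕ} (μ : Fin P.d) : ∀ (N : ℕ) (y : Site P j) (s : LStep P j), s ∈ walk y (List.replicate N (μ, true)) →
    ∃ t : ℕ, t < N ∧ s.bond = ⟨(fun z : Site P j => z.shift μ)^[t] y, μ⟩
  | 0, y, s, hs => by simp [walk] at hs
  | N + 1, y, s, hs => by
    rw [List.replicate_succ, walk, List.mem_cons] at hs
    rcases hs with rfl | hs
    · exact ⟨0, Nat.succ_pos N, rfl⟩
    · obtain ⟨t, ht, hb⟩ := mem_walk_replicate μ N (y.shift μ) s hs
      exact ⟨t + 1, by omega, by rw [hb, Function.iterate_succ_apply]⟩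

/-! ## §2 Equal transports along the line -/

section Transport

variable {G : Type*} [GaugeGroup G]

/-- **★ TWO FIELDS AGREEING ON THE `N` BONDS OF A STRAIGHT LINE HAVE THE SAME AXIAL TRANSPORT TO ITS END** (`2N ≤ n`: no wrap-around). [cite: Balaban1985Averaging, (8)–(9) p.18, pp.24–25] -/
theorem axialT_line_congr {j : ℕ} (U W : GaugeField P j G) (y : Site P j) (μ : Fin P.d) (N : ℕ) (hN : (N : ℤ) * 2 ≤ (P.sitesPerDir j : ℤ))
    (h : ∀ t : ℕ, t < N → U ⟨(fun z : Site P j => z.shift μ)^[t] y, μ⟩ = W ⟨(fun z : Site P j => z.shift μ)^[t] y, μ⟩) :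
    axialT U y ((fun z : Site P j => z.shift μ)^[N] y) = axialT W y ((fun z : Site P j => z.shift μ)^[N] y) := by
  refine axialT_congr_of_walk U W y _ fun s hs => ?_
  rw [rel_lineVec y μ N hN, treeWord_lineVec] at hs
  obtain ⟨t, ht, hb⟩ := mem_walk_replicate μ N y s hs
  rw [hb]; exact h t ht

end Transport

/-! ## §3 The next centre is `L^k` fine steps away -/

/-- **`toFine k (y + e_μ) = shift_μ^{[L^k]} (toFine k y)`** (`k ≤ m + K`): the centre of the next `k`-cell lies `L^k` finest steps along `μ` (the centred labels `y_μ·L^k + ⌊L^k/2⌋`,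
and `sitesPerDir 0 = sitesPerDir k · L^k` absorbs the wrap-around). [cite: Balaban1987RG1, (0.1) p.251] -/
theorem toFine_shift {k : ℕ} (hk : k ≤ P.m + P.K) (y : Site P k) (μ : Fin P.d) :
    toFine k (y.shift μ) = (fun z : Site P 0 => z.shift μ)^[P.L ^ k] (toFine k y) := by
  rw [← transl_lineVec]
  funext ν
  rw [B10Eq27TorusAxialLog.transl_apply]
  -- both sides through their natural-number labels
  have hL := val_toFine k hk (y.shift μ) ν
  have hR := val_toFine k hk y ν
  rw [← ZMod.natCast_zmod_val (toFine k (y.shift μ) ν), ← ZMod.natCast_zmod_val (toFine k y ν), hL, hR]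
  simp only [lineVec]
  by_cases hν : ν = μ
  · subst hν
    rw [if_pos rfl, B10StarCount.shift_apply_self, ZMod.val_add, ZMod.val_one_eq_one_mod, Nat.add_mod_mod, Int.cast_natCast]
    -- `((y_μ + 1) mod n_k)·L^k ≡ (y_μ + 1)·L^k (mod n_0 = n_k·L^k)`
    have hmod : (((y ν).val + 1) % P.sitesPerDir k * P.L ^ k + P.L ^ k / 2 : ℕ) % P.sitesPerDir 0 = (((y ν).val + 1) * P.L ^ k + P.L ^ k / 2) % P.sitesPerDir 0 := by
      rw [sitesPerDir_zero_eq_mul_pow hk, ← Nat.mul_mod_mul_right, Nat.add_mod, Nat.mod_mod_of_dvd _ (dvd_refl _), ← Nat.add_mod]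
    rw [← ZMod.natCast_mod, hmod, ZMod.natCast_mod]
    push_cast; ring
  · rw [if_neg hν, B10StarCount.shift_apply_ne _ hν, Int.cast_zero, add_zero]

/-- **★★ AGREEMENT ON THE CENTRE LINE ⟹ EQUAL TRANSPORTS `ĉ₋ → ĉ₊`** (`k ≤ m + K`, `2L^k ≤ sitesPerDir 0`): for a level-`k` bond `c`, if `U = W` on the `L^k` finest bonds
`⟨shift^{[t]} ĉ₋, c.dir⟩`, `t < L^k`, then `axialT U ĉ₋ ĉ₊ = axialT W ĉ₋ ĉ₊` — the binder `hline` of `norm_startDefect_sub_one_le_of_box`. [cite: Balaban1985Averaging, (8)–(9) p.18, pp.24–25] -/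
theorem axialT_centre_congr {G : Type*} [GaugeGroup G] {k : ℕ} (hk : k ≤ P.m + P.K) (hN : ((P.L ^ k : ℕ) : ℤ) * 2 ≤ (P.sitesPerDir 0 : ℤ)) (U W : GaugeField P 0 G) (c : PBond P k)
    (h : ∀ t : ℕ, t < P.L ^ k → U ⟨(fun z : Site P 0 => z.shift c.dir)^[t] (toFine k c.src), c.dir⟩ = W ⟨(fun z : Site P 0 => z.shift c.dir)^[t] (toFine k c.src), c.dir⟩) :
    axialT U (toFine k c.src) (toFine k c.tgt) = axialT W (toFine k c.src) (toFine k c.tgt) := by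
  have htgt : toFine k c.tgt = (fun z : Site P 0 => z.shift c.dir)^[P.L ^ k] (toFine k c.src) := toFine_shift hk c.src c.dir
  rw [htgt]
  exact axialT_line_congr U W (toFine k c.src) c.dir (P.L ^ k) hN h

end Summit.QuantumFields.YangMills.Theorems.StartDefectBox
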